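import Summits.NavierStokesRegularity.NavierStokesRegularity.Theorems.ScenarioCensusParityMeterWindow
import Summits.NavierStokesRegularity.NavierStokesRegularity.Theorems.ScenarioCensusRoughnessMeterRows
import Summits.NavierStokesRegularity.NavierStokesRegularity.Theorems.ScenarioCensusDeviatorMeterStress
import HarnessLib

/-!
# LINE «parity-meter» port, part 3/3: §E the rows, §F proofs of the decided rows, §G nestings and controls (incl. the cross-line nesting A2pd ⇒ A2os, the roughness-meter
# head taken BY NAME); census KEYS `Row_A2np` / `Row_A2pe` / `Row_A2pd` / `Row_A2pc` / `Row_A2pb` / `Row_A2ai` + `_excluded`, `Row_A2pm` (OPEN)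

Re-homed for the scenario census (typer seat ns-census-typer-1 g9; the cells A2np / A2pe / A2pd / A2pc / A2pb / A2ai are MEMBERS OF RECORD «DECIDED IN KERNEL IN FILES»
of block A2 since census v1.77 (critic idea-crit-3 PASS 02:53Z; ref ns-census-ref g10 PRE-CHECK ✓ §15.18 item 42; lead-presearch label); this port makes them
TREE-decided): VERBATIM PORT of ns-idea-2 LINE «parity-meter», `pub/ideators/ns-idea-2/lines/parity-meter/line-parity-meter.lean` sha16 d578da454eaab7e9 (775 l.,
lean check rc 0, 0 sorry), split for the 400-line rule into `ScenarioCensusParityMeter` (§A–§B) → `…ParityMeterWindow` (§C–§D) → `…ParityMeterRows` (§E–§G +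
census KEYS).  Lean text VERBATIM in namespace `…Theorems.ScenarioCensus.ParityMeter` (the line's `…Lines.ParityMeter` re-homed); port edits: `local notation
"E3"` → `abbrev E3` (typer lint: no notation in port files), `@[conjecture]` on the OPEN row `Row_A2pm` (typed only), eight one-line docstrings added (gate lint);
the constant `kernelConst` (+ `_pos` / `_spec`), the two `rpow` window integrals, `one_div_sqrt_two_lt_one` and the roughness head `Row_A2os`, which the line shares
VERBATIM with the landed roughness-meter / deviator-meter ports, are taken BY NAME (listed below).  Statements untouched.

No census VALUE is moved here (the cells become TREE-decided by name; booking is the lead's); NS regularity is NOT proved; (L′) ⟨10661⟩ is untouched; no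
summit statement is proved by this file. Lemmas that restate already-landed tree declarations are taken BY NAME (gate lint `dedup.landed`): `kernelConst` = `RoughnessMeter.kernelConst`, `kernelConst_pos` = `RoughnessMeter.kernelConst_pos`, `kernelConst_spec` = `RoughnessMeter.kernelConst_spec`, `integrableOn_sub_rpow` = `RoughnessMeter.integrableOn_sub_rpow`, `setIntegral_sub_rpow` = `RoughnessMeter.setIntegral_sub_rpow`, `one_div_sqrt_two_lt_one` = `DeviatorMeter.one_div_sqrt_two_lt_one`, `Row_A2os` = `RoughnessMeter.Row_A2os`.
-/

-- the summit and its single problem share the name `NavierStokesRegularity` (D-0017 nested layout)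
set_option linter.dupNamespace false

noncomputable section

open Set Function Filter Topology Metric MeasureTheory

namespace Summit.NavierStokesRegularity.NavierStokesRegularity.Theorems.ScenarioCensus.ParityMeter

open Literature.Analysis Literature.Analysis.FluidPDE
open Summit.NavierStokesRegularity.NavierStokesRegularity.Theorems.SimilarityEnstrophy
  (typeI_ancient_eq_zero_of_rate_lt_one)
open Summit.NavierStokesRegularity.NavierStokesRegularity.Theorems.SymmetryModuliCountSymmetricLiouville
  (vanishes_of_vanishes_before isTypeIAncientMild_comp_add_right
    isTypeIAncientMild_conj_linearIsometryEquiv)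

/-! ## E. The rows (census A-block cells, (L′)-shape over `IsTypeIAncientMild C u` BY NAME) -/

/-- **Row A2np (NEAR-OPPOSITE PAIRS; the ENGINE row, PROVED, UNIVERSAL).**  There is a universal
`η₀ > 0` such that for ALL constants `C, C'`: two Type-I ancient mild fields `u ∈ A_C`, `w ∈ A_{C'}`
whose sum is scale-invariantly small on every slice, `√(-t) ‖u(t,x) + w(t,x)‖ ≤ η₀`, both vanish.
(`-w` solves the Oseen equation with the OPPOSITE sign of the quadratic term; the row says the
class `A_C` and its negative `-A_{C'}` are uniformly `η₀`-separated in the scale-invariant sup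
metric, away from their common point `0`.  With `w = 0` or `w = u` it is the small-constant cell
A2a; with `w` the odd reflection of `u` it is the parity cell A2pd.) -/
def Row_A2np : Prop :=
  ∃ η₀ : ℝ, 0 < η₀ ∧ ∀ (C C' : ℝ) (u w : ℝ → E3 → E3),
    IsTypeIAncientMild C u → IsTypeIAncientMild C' w →
      (∀ t < 0, ∀ x, Real.sqrt (-t) * ‖u t x + w t x‖ ≤ η₀) →
        ∀ t < 0, ∀ x, u t x = 0

/-- **Row A2pe (THE EVEN CORNER; PROVED, EXACT — no threshold).**  A Type-I ancient mild field
(any constant `C`) all of whose slices are EVEN about the origin, `u(t, -x) = u(t, x)`, vanishes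
identically.  (Evenness is NOT a symmetry of the equation — the natural action of the central
inversion `-I ∈ O(3)` makes `u` ODD; an even field has an odd, hence trivial, solenoidal
quadratic term and is caloric.)  Contains KNSS Remark 6.1 (slice-constant fields are even). -/
def Row_A2pe : Prop :=
  ∀ (C : ℝ) (u : ℝ → E3 → E3), IsTypeIAncientMild C u →
    (∀ t < 0, ∀ x, u t (-x) = u t x) → ∀ t < 0, ∀ x, u t x = 0

/-- **Row A2pd (PARITY-DEFECT FLOOR; HEAD instrument row, PROVED, UNIVERSAL).**  There is a
universal `η₀ > 0` such that every Type-I ancient mild field (ANY constant `C`) whose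
scale-invariant ODD PART about the origin is small on every slice,
`√(-t) ‖u(t, x) - u(t, -x)‖ ≤ η₀` for all `t < 0`, `x`, vanishes identically.  NO smallness of `u`
is assumed: the even part may carry the full Type-I amplitude. -/
def Row_A2pd : Prop :=
  ∃ η₀ : ℝ, 0 < η₀ ∧ ∀ (C : ℝ) (u : ℝ → E3 → E3), IsTypeIAncientMild C u →
    (∀ t < 0, ∀ x, Real.sqrt (-t) * ‖u t x - u t (-x)‖ ≤ η₀) →
      ∀ t < 0, ∀ x, u t x = 0

/-- **Row A2pc (parity defect about an ARBITRARY FIXED centre `c`; PROVED, by translation).** -/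
def Row_A2pc : Prop :=
  ∃ η₀ : ℝ, 0 < η₀ ∧ ∀ (C : ℝ) (u : ℝ → E3 → E3) (c : E3), IsTypeIAncientMild C u →
    (∀ t < 0, ∀ x, Real.sqrt (-t) * ‖u t (c + x) - u t (c - x)‖ ≤ η₀) →
      ∀ t < 0, ∀ x, u t x = 0

/-- **Row A2pb (parity defect small only on a BACKWARD END `t ≤ T`; PROVED — time shift into the
past keeps the class, forward uniqueness `vanishes_of_vanishes_before` propagates the zero).** -/
def Row_A2pb : Prop :=
  ∃ η₀ : ℝ, 0 < η₀ ∧ ∀ (C : ℝ) (u : ℝ → E3 → E3), IsTypeIAncientMild C u →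
    (∃ T < 0, ∀ t ≤ T, ∀ x, Real.sqrt (-t) * ‖u t x - u t (-x)‖ ≤ η₀) →
      ∀ t < 0, ∀ x, u t x = 0

/-- **Row A2ai (ANTI-EQUIVARIANT SECTORS, every linear isometry; PROVED, UNIVERSAL).**  For every
`L ∈ O(3)` the natural action `u ↦ L u(L⁻¹ ·)` preserves the class; the EQUIVARIANT sector
`u = L u(L⁻¹ ·)` is a symmetric-Liouville problem (census A3/A9, route SymmetryModuliCount), but
the ANTI-EQUIVARIANT sector is uniformly empty: `√(-t) ‖u(t,x) + L u(t, L⁻¹x)‖ ≤ η₀` for all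
`t < 0`, `x` forces `u ≡ 0` (`L = -I`: the parity cell; `L = I`: the cell A2a; `L` a mirror:
"anti-mirror" fields `u(σx) = -σu(x)`). -/
def Row_A2ai : Prop :=
  ∃ η₀ : ℝ, 0 < η₀ ∧ ∀ (C : ℝ) (u : ℝ → E3 → E3) (L : E3 ≃ₗᵢ[ℝ] E3), IsTypeIAncientMild C u →
    (∀ t < 0, ∀ x, Real.sqrt (-t) * ‖u t x + L (u t (L.symm x))‖ ≤ η₀) →
      ∀ t < 0, ∀ x, u t x = 0

/-- **Row A2pm (parity defect about a MOVING centre `c(t)`; OPEN, typed only).**  The natural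
next cell: near-evenness about a time-dependent centre.  The pair engine does not apply as it
stands (the reflected field `-u(t, 2c(t) - x)` is in the class only for constant `c`); at the PDE
level an exactly even field about a `C¹` centre is caloric in the co-moving frame, but no mild-class
proof is offered here.  NOT claimed. -/
@[conjecture] def Row_A2pm : Prop :=
  ∃ η₀ : ℝ, 0 < η₀ ∧ ∀ (C : ℝ) (u : ℝ → E3 → E3), IsTypeIAncientMild C u →
    (∀ t < 0, ∃ c : E3, ∀ x, Real.sqrt (-t) * ‖u t (c + x) - u t (c - x)‖ ≤ η₀) →
      ∀ t < 0, ∀ x, u t x = 0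

-- `Row_A2os`: the line restates the tree's `RoughnessMeter.Row_A2os`; taken BY NAME (gate lint dedup.landed).

/-! ## F. Proofs of the decided rows -/

/-- **Row A2np holds** (near-opposite pairs; the engine row). -/
theorem row_A2np_holds : Row_A2np := by
  refine ⟨parityThreshold, parityThreshold_pos, fun C C' u w hu hw hsum => ?_⟩
  exact eq_zero_of_near_opposite hu hw parityThreshold_pos.le
    (by linarith [parityThreshold_le_one]) parityThreshold_contracts hsum

/-- The odd reflection `(t, x) ↦ -u(t, -x)` of an element of `A_C` lies in `A_C` (the natural
action of the central inversion `-I`; tree: `isTypeIAncientMild_conj_linearIsometryEquiv`). -/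
theorem reflect_mem {C : ℝ} {u : ℝ → E3 → E3} (hu : IsTypeIAncientMild C u) :
    IsTypeIAncientMild C (fun t x => -(u t (-x))) :=
  isTypeIAncientMild_conj_linearIsometryEquiv hu (LinearIsometryEquiv.neg ℝ)

/-- **A2ai PROVED** from the engine: `w = L u(L⁻¹ ·) ∈ A_C`. -/
theorem row_A2ai_holds : Row_A2ai := by
  obtain ⟨η₀, hη₀, H⟩ := row_A2np_holds
  refine ⟨η₀, hη₀, fun C u L hu hanti => ?_⟩
  exact H C C u (fun t x => L (u t (L.symm x))) hu
    (isTypeIAncientMild_conj_linearIsometryEquiv hu L) hanti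

/-- **A2pd PROVED** from the engine: `w` = the odd reflection, `u + w = u - u(·, -·)`. -/
theorem row_A2pd_holds : Row_A2pd := by
  obtain ⟨η₀, hη₀, H⟩ := row_A2np_holds
  refine ⟨η₀, hη₀, fun C u hu hdef => ?_⟩
  refine H C C u (fun t x => -(u t (-x))) hu (reflect_mem hu) (fun t ht x => ?_)
  simpa [sub_eq_add_neg] using hdef t ht x

/-- **A2pe PROVED**: the even corner has parity defect `0`. -/
theorem row_A2pe_holds : Row_A2pe := by
  obtain ⟨η₀, hη₀, H⟩ := row_A2pd_holds
  intro C u hu hev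
  refine H C u hu (fun t ht x => ?_)
  rw [hev t ht x, sub_self, norm_zero, mul_zero]
  exact hη₀.le

/-- **A2pc PROVED**: translate the centre to the origin (`isTypeIAncientMild_comp_add_right`). -/
theorem row_A2pc_holds : Row_A2pc := by
  obtain ⟨η₀, hη₀, H⟩ := row_A2pd_holds
  refine ⟨η₀, hη₀, fun C u c hu hdef t ht x => ?_⟩
  have hv : IsTypeIAncientMild C (fun t x => u t (x + c)) := isTypeIAncientMild_comp_add_right hu c
  have hz := H C (fun t x => u t (x + c)) hv (fun t ht x => by
    have h1 := hdef t ht x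
    have e1 : x + c = c + x := add_comm x c
    have e2 : -x + c = c - x := by abel
    simp only [e1, e2]
    exact h1) t ht (x - c)
  simpa using hz

/-- **A2pb PROVED**: shift into the past, then forward uniqueness. -/
theorem row_A2pb_holds : Row_A2pb := by
  obtain ⟨η₀, hη₀, H⟩ := row_A2pd_holds
  refine ⟨η₀, hη₀, fun C u hu hend => ?_⟩
  obtain ⟨T, hT, hdef⟩ := hend
  have hv : IsTypeIAncientMild C (fun t => u (t - (-T))) := hu.comp_sub_right (by linarith)
  have hz := H C (fun t => u (t - (-T))) hv (fun t ht x => by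
    have hτ : t - (-T) ≤ T := by linarith
    have hτ0 : t - (-T) < 0 := by linarith
    have hst : Real.sqrt (-t) ≤ Real.sqrt (-(t - (-T))) := Real.sqrt_le_sqrt (by linarith)
    have key := hdef _ hτ x
    exact (mul_le_mul_of_nonneg_right hst (norm_nonneg _)).trans key)
  refine vanishes_of_vanishes_before hu hT (fun t ht x => ?_)
  have := hz (t - T) (by linarith) x
  simpa using this

/-! ## G. Nestings and controls -/

/-- Engine ⇒ anti-equivariant sectors ⇒ parity floor ⇒ even corner (the lattice of the line). -/
theorem row_A2pd_of_row_A2ai : Row_A2ai → Row_A2pd := by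
  rintro ⟨η₀, hη₀, H⟩
  refine ⟨η₀, hη₀, fun C u hu hdef => H C u (LinearIsometryEquiv.neg ℝ) hu (fun t ht x => ?_)⟩
  simpa [sub_eq_add_neg] using hdef t ht x

/-- Nesting: the parity-defect floor implies the even corner. -/
theorem row_A2pe_of_row_A2pd : Row_A2pd → Row_A2pe := by
  rintro ⟨η₀, hη₀, H⟩ C u hu hev
  refine H C u hu (fun t ht x => ?_)
  rw [hev t ht x, sub_self, norm_zero, mul_zero]
  exact hη₀.le

/-- The moving-centre cell contains the fixed-centre one. -/
theorem row_A2pc_of_row_A2pm : Row_A2pm → Row_A2pc := by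
  rintro ⟨η₀, hη₀, H⟩
  exact ⟨η₀, hη₀, fun C u c hu hdef => H C u hu (fun t ht => ⟨c, hdef t ht⟩)⟩

/-- **CROSS-LINE NESTING**: the parity floor implies the roughness line's oscillation floor
(the parity defect `‖u(x) - u(-x)‖` is at most the oscillation) — A2pd is STRICTLY upstream of
A2os in the census lattice. -/
theorem row_A2os_of_row_A2pd : Row_A2pd → RoughnessMeter.Row_A2os := by
  rintro ⟨η₀, hη₀, H⟩
  exact ⟨η₀, hη₀, fun C u hu hosc => H C u hu (fun t ht x => hosc t ht x (-x))⟩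

/-- **Control (the even corner contains KNSS Remark 6.1)**: slice-constant fields are even, so
A2pe recovers the tree's `eq_zero_of_slice_const`-type Liouville statement. -/
theorem sliceConst_case_of_row_A2pe (H : Row_A2pe) {C : ℝ} {u : ℝ → E3 → E3}
    (hu : IsTypeIAncientMild C u) {b : ℝ → E3} (hb : ∀ t < 0, ∀ x, u t x = b t) :
    ∀ t < 0, ∀ x, u t x = 0 :=
  H C u hu (fun t ht x => by rw [hb t ht x, hb t ht (-x)])

/-- **Control (the class hypothesis is load-bearing)**: WITHOUT `IsTypeIAncientMild`, even fields
need not vanish (a nonzero constant field is even). -/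
theorem even_not_enough :
    ¬ (∀ u : ℝ → E3 → E3, (∀ t < 0, ∀ x, u t (-x) = u t x) → ∀ t < 0, ∀ x, u t x = 0) := by
  intro H
  have h := H (fun _ _ => EuclideanSpace.single 0 1) (fun _ _ _ => rfl) (-1) (by norm_num) 0
  have : (EuclideanSpace.single (0 : Fin 3) (1 : ℝ)) 0 = 0 := by rw [h]; rfl
  simp at this

/-- **Control (the threshold is universal and explicit)**: the rows hold with the SAME
`η₀ = parityThreshold = min 1 ((1 - 1/√2)/(2 K_P))` for every `C`. -/
theorem universal_threshold :
    ∀ (C C' : ℝ) (u w : ℝ → E3 → E3), IsTypeIAncientMild C u → IsTypeIAncientMild C' w →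
      (∀ t < 0, ∀ x, Real.sqrt (-t) * ‖u t x + w t x‖ ≤ parityThreshold) →
        ∀ t < 0, ∀ x, u t x = 0 :=
  fun C C' u w hu hw hsum => eq_zero_of_near_opposite hu hw parityThreshold_pos.le
    (by linarith [parityThreshold_le_one]) parityThreshold_contracts hsum

end Summit.NavierStokesRegularity.NavierStokesRegularity.Theorems.ScenarioCensus.ParityMeter

namespace Summit.NavierStokesRegularity.NavierStokesRegularity.Theorems.ScenarioCensus

/-! ## Census KEYS (ns `…Theorems.ScenarioCensus`): instrument PARITY METER (block A2) — TREE-decided cells A2np / A2pe / A2pd / A2pc / A2pb / A2ai, OPEN row A2pm -/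

/-- **Cell A2np** (NEAR-OPPOSITE PAIRS, universal `η₀`; the engine row): `:= ParityMeter.Row_A2np`. DECIDED. -/
def Row_A2np : Prop := ParityMeter.Row_A2np
/-- A2np is EXCLUDED (decided in the tree): `ParityMeter.row_A2np_holds`. -/
theorem row_A2np_excluded : Row_A2np := ParityMeter.row_A2np_holds

/-- **Cell A2pe** (THE EVEN CORNER, threshold-free: even slices ⇒ `u ≡ 0`): `:= ParityMeter.Row_A2pe`. DECIDED. -/
def Row_A2pe : Prop := ParityMeter.Row_A2pe
/-- A2pe is EXCLUDED (decided in the tree): `ParityMeter.row_A2pe_holds`. -/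
theorem row_A2pe_excluded : Row_A2pe := ParityMeter.row_A2pe_holds

/-- **Cell A2pd** (PARITY-DEFECT FLOOR, head instrument row, universal `η₀`): `:= ParityMeter.Row_A2pd`. DECIDED. -/
def Row_A2pd : Prop := ParityMeter.Row_A2pd
/-- A2pd is EXCLUDED (decided in the tree): `ParityMeter.row_A2pd_holds`. -/
theorem row_A2pd_excluded : Row_A2pd := ParityMeter.row_A2pd_holds

/-- **Cell A2pc** (parity defect about an arbitrary FIXED centre): `:= ParityMeter.Row_A2pc`. DECIDED. -/
def Row_A2pc : Prop := ParityMeter.Row_A2pc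
/-- A2pc is EXCLUDED (decided in the tree): `ParityMeter.row_A2pc_holds`. -/
theorem row_A2pc_excluded : Row_A2pc := ParityMeter.row_A2pc_holds

/-- **Cell A2pb** (parity defect small only on a BACKWARD END): `:= ParityMeter.Row_A2pb`. DECIDED. -/
def Row_A2pb : Prop := ParityMeter.Row_A2pb
/-- A2pb is EXCLUDED (decided in the tree): `ParityMeter.row_A2pb_holds`. -/
theorem row_A2pb_excluded : Row_A2pb := ParityMeter.row_A2pb_holds

/-- **Cell A2ai** (ANTI-EQUIVARIANT SECTORS, every linear isometry, universal `η₀`): `:= ParityMeter.Row_A2ai`. DECIDED. -/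
def Row_A2ai : Prop := ParityMeter.Row_A2ai
/-- A2ai is EXCLUDED (decided in the tree): `ParityMeter.row_A2ai_holds`. -/
theorem row_A2ai_excluded : Row_A2ai := ParityMeter.row_A2ai_holds

/-- **Row A2pm** (parity defect about a MOVING centre) — typed only: `:= ParityMeter.Row_A2pm`. OPEN (no witness, no proof). -/
@[conjecture] def Row_A2pm : Prop := ParityMeter.Row_A2pm

/-- Lattice edges at key level: A2ai → A2pd → A2pe, A2pm → A2pc, and the cross-line nesting A2pd → A2os (roughness-meter head) (`ParityMeter.row_A2pd_of_row_A2ai` /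
`row_A2pe_of_row_A2pd` / `row_A2pc_of_row_A2pm` / `row_A2os_of_row_A2pd`). -/
theorem row_A2pd_of_row_A2ai : Row_A2ai → Row_A2pd := ParityMeter.row_A2pd_of_row_A2ai
/-- See `row_A2pd_of_row_A2ai`. -/
theorem row_A2pe_of_row_A2pd : Row_A2pd → Row_A2pe := ParityMeter.row_A2pe_of_row_A2pd
/-- See `row_A2pd_of_row_A2ai`. -/
theorem row_A2pc_of_row_A2pm : Row_A2pm → Row_A2pc := ParityMeter.row_A2pc_of_row_A2pm
/-- See `row_A2pd_of_row_A2ai`. -/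
theorem row_A2os_of_row_A2pd : Row_A2pd → Row_A2os := ParityMeter.row_A2os_of_row_A2pd

end Summit.NavierStokesRegularity.NavierStokesRegularity.Theorems.ScenarioCensus

end
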